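import Literature.Probability.LatticeModels.CriticalTwoPointBounds
import Literature.Probability.LatticeModels.IsingBoundaryMonotonicity
import Literature.Probability.LatticeModels.FreeStateGibbs
import HarnessLib

/-!
# Uniqueness of the Ising Gibbs measure from `⟨σ_x⟩⁺ = 0`, below and at `β_c` (`d ≥ 3`)

Topic `Probability/LatticeModels`. Theorem-only file (no definitions, no named facts): discharge
of the named facts

* `hasUniqueGibbsMeasure_of_plusExpect_spinAt_eq_zero` (`MagnetizationContinuity.lean`;
  Aizenman–Duminil-Copin–Sidoravicius, CMP 334 (2015), Prop. B.1 (Appendix B), after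
  Lebowitz–Martin-Löf 1972; Friedli–Velenik 2017, Thm. 3.28 with §3.7.2, p. 120): for the
  nearest-neighbour Ising model on `ℤ^d` at `β ≥ 0`, `h = 0`, if `⟨σ_x⟩⁺_β = 0` for all `x` then
  `|𝒢(β, 0)| = 1`;
* `hasUniqueGibbsMeasure_of_lt_criticalBeta` (`GibbsStates.lean`, crit-ising.S25: uniqueness for
  `0 ≤ β < β_c(d)`);
* `hasUniqueGibbsMeasure_criticalBeta_of_lroTildeSq` (`MagnetizationContinuity.lean`; ADS15
  Thm. 1.2, second assertion) and **`hasUniqueGibbsMeasure_criticalBeta`** (`Sharpness.lean`,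
  crit-ising.S09: a unique Gibbs measure at `(β_c, 0)` for `d ≥ 3`).

## The argument (Friedli–Velenik 2017, Thm. 3.28, p. 117, and Lemma 6.65, eq. (6.70), p. 311)

For a finite set of sites `B` let `E_B = {σ | σ_i = +1 ∀ i ∈ B}` (the event `n_B = 1` of
Friedli–Velenik, `n_i = (1 + σ_i)/2`), an increasing cylinder event.

1. *Finite volume.* By monotonicity in the boundary condition (Friedli–Velenik 2017, Lemma 3.23 /
   Exercise 3.13; tree theorem `isingExpect_fixed_mono`), for every `η`:
   `μ⁻_Λ(E_B) ≤ μ^η_Λ(E_B) ≤ μ⁺_Λ(E_B)`; and since `∑_{i ∈ B} n_i - n_B` is nondecreasing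
   (Friedli–Velenik 2017, Exercise 3.10),
   `μ⁺_Λ(E_B) - μ⁻_Λ(E_B) ≤ ∑_{i ∈ B} (μ⁺_Λ(E_i) - μ⁻_Λ(E_i))`.
2. *DLR sandwich* (Friedli–Velenik 2017, eq. (6.70)): for `μ ∈ 𝒢(β, h)`,
   `μ(E_B) = ∫ μ^η_Λ(E_B) μ(dη) ∈ [μ⁻_Λ(E_B), μ⁺_Λ(E_B)]`.
3. Hence two Gibbs measures differ on `E_B` by at most `∑_{i ∈ B} (μ⁺_{Λ_n}(E_i) - μ⁻_{Λ_n}(E_i))`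
   for every `n`; if these single-site gaps tend to `0` along some sequence of volumes, all Gibbs
   measures agree on the `π`-system `{E_B}`, which generates the product `σ`-algebra, so
   `𝒢(β, h)` has at most one element (`ext_of_generate_finite`).
4. At `h = 0`, spin-flip symmetry gives `μ⁺_Λ(E_i) - μ⁻_Λ(E_i) = ⟨σ_i⟩⁺_Λ`
   (Friedli–Velenik 2017, §3.7.2, p. 120: `⟨σ_0⟩⁻_{β,0} = -⟨σ_0⟩⁺_{β,0}`), and along boxes
   `⟨σ_i⟩⁺_{Λ_L} → ⟨σ_i⟩⁺_β`; existence of a Gibbs measure is the tree theorem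
   `exists_freeMeasure_holds`.
5. `⟨σ_i⟩⁺_β = m*(β)` (translation invariance, `plusExpect_spinAt_eq_spontaneousMagnetization_holds`),
   and `m*(β) = 0` for `β < β_c` (definition of `β_c` and `m* ≥ 0`,
   `spontaneousMagnetization_nonneg_holds`) and for `β = β_c`, `d ≥ 3` (`spontaneousMagnetization_criticalBeta_eq_zero_holds`,
   Aizenman–Duminil-Copin–Sidoravicius 2015).

## References

* S. Friedli, Y. Velenik, *Statistical Mechanics of Lattice Systems* (CUP 2017), Exercise 3.10
  (p. 110), Lemma 3.23 and Exercise 3.13 (pp. 112–113), Thm. 3.28 (p. 117), Def. 3.32 and the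
  preceding paragraph (p. 120), Lemma 6.65 with eq. (6.70) (p. 311).
* M. Aizenman, H. Duminil-Copin, V. Sidoravicius, *Random currents and continuity of Ising
  model's spontaneous magnetization*, Comm. Math. Phys. 334 (2015) 719–742, Thm. 1.2, Prop. B.1.
* J. L. Lebowitz, A. Martin-Löf, *On the uniqueness of the equilibrium state for Ising spin
  systems*, Comm. Math. Phys. 25 (1972) 276–282.

## Mathlib

`MeasureTheory.ext_of_generate_finite`, `measurable_to_countable'`, `Measurable.comap_le`,
`MeasureTheory.lintegral_mono`, `MeasureTheory.integral_indicator_one`. No Gibbs measures in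
Mathlib.
-/

noncomputable section

open MeasureTheory Filter Topology Finset
open scoped ENNReal

namespace Literature.Probability.LatticeModels

/-! ### Increasing cylinder events `E_B = {σ | σ_i = 1 ∀ i ∈ B}` -/

section Events

variable {V : Type*}

/-- A spin is `-1` iff it is not `+1`. [folklore] -/
theorem intUnits_eq_neg_one_iff (u : ℤˣ) : u = -1 ↔ u ≠ 1 := by
  rcases Int.units_eq_one_or u with rfl | rfl <;> decide

/-- The cylinder event `{σ_i = 1 ∀ i ∈ B}` is measurable (product `σ`-algebra, `ℤˣ` discrete)
(Friedli–Velenik 2017, §6.2). [cite: FriedliVelenik2017, §6.2] -/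
theorem measurableSet_forall_eq_one (B : Finset V) :
    MeasurableSet {σ : SpinConfig V | ∀ i ∈ B, σ i = 1} := by
  have h : {σ : SpinConfig V | ∀ i ∈ B, σ i = 1} =
      ⋂ i ∈ B, (fun σ : SpinConfig V => σ i) ⁻¹' {1} := by
    ext σ
    simp
  rw [h]
  exact Finset.measurableSet_biInter B fun i _ => measurable_pi_apply i (MeasurableSet.singleton 1)

/-- The single-site event `{σ_i = 1}` is measurable. [cite: FriedliVelenik2017, §6.2] -/
theorem measurableSet_eq_one (i : V) : MeasurableSet {σ : SpinConfig V | σ i = 1} :=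
  measurable_pi_apply i (MeasurableSet.singleton 1)

/-- `{σ_i = 1 ∀ i ∈ B}` is an increasing event: its indicator (`n_B` of Friedli–Velenik) is
nondecreasing (Friedli–Velenik 2017, Exercise 3.10, p. 110). [cite: FriedliVelenik2017, Exercise 3.10, p. 110] -/
theorem mem_forall_eq_one_of_le {B : Finset V} {σ τ : SpinConfig V} (hle : σ ≤ τ)
    (hσ : σ ∈ {σ : SpinConfig V | ∀ i ∈ B, σ i = 1}) :
    τ ∈ {σ : SpinConfig V | ∀ i ∈ B, σ i = 1} := by
  intro i hi
  have h1 : σ i ≤ τ i := hle i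
  rw [hσ i hi] at h1
  exact le_antisymm (intUnits_le_one (τ i)) h1

/-- `n_B = 𝟙{σ_i = 1 ∀ i ∈ B}` is nondecreasing (Friedli–Velenik 2017, Exercise 3.10, p. 110). [cite: FriedliVelenik2017, Exercise 3.10, p. 110] -/
theorem monotone_indicator_forall_eq_one (B : Finset V) :
    Monotone (({σ : SpinConfig V | ∀ i ∈ B, σ i = 1}).indicator (1 : SpinConfig V → ℝ)) := by
  intro σ τ hle
  by_cases hσ : σ ∈ {σ : SpinConfig V | ∀ i ∈ B, σ i = 1}
  · rw [Set.indicator_of_mem hσ, Set.indicator_of_mem (mem_forall_eq_one_of_le hle hσ)]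
    exact le_rfl
  · rw [Set.indicator_of_notMem hσ]
    exact Set.indicator_nonneg (fun _ _ => zero_le_one) _

/-- `∑_{i ∈ B} n_i - n_B` is nondecreasing (Friedli–Velenik 2017, Exercise 3.10, p. 110; used in
the proof of Thm. 3.28, p. 117): flipping spins up inside `B` raises `∑ n_i` by at least as much
as it can raise `n_B ∈ {0, 1}`. [cite: FriedliVelenik2017, Exercise 3.10, p. 110] -/
theorem monotone_sum_indicator_sub_indicator (B : Finset V) :
    Monotone fun σ : SpinConfig V =>
      (∑ i ∈ B, ({σ : SpinConfig V | σ i = 1}).indicator (1 : SpinConfig V → ℝ) σ) -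
        ({σ : SpinConfig V | ∀ i ∈ B, σ i = 1}).indicator (1 : SpinConfig V → ℝ) σ := by
  classical
  intro σ τ hle
  -- single-site indicators are termwise nondecreasing and bounded by `1`
  have hterm : ∀ i, ({σ : SpinConfig V | σ i = 1}).indicator (1 : SpinConfig V → ℝ) σ ≤
      ({σ : SpinConfig V | σ i = 1}).indicator (1 : SpinConfig V → ℝ) τ := fun i => by
    by_cases hσ : σ ∈ {σ : SpinConfig V | σ i = 1}
    · have hτ : τ ∈ {σ : SpinConfig V | σ i = 1} := by
        have h1 : σ i ≤ τ i := hle i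
        rw [show σ i = 1 from hσ] at h1
        exact le_antisymm (intUnits_le_one (τ i)) h1
      rw [Set.indicator_of_mem hσ, Set.indicator_of_mem hτ]
      exact le_rfl
    · rw [Set.indicator_of_notMem hσ]
      exact Set.indicator_nonneg (fun _ _ => zero_le_one) _
  have hle1 : ∀ (ρ : SpinConfig V) (i : V),
      ({σ : SpinConfig V | σ i = 1}).indicator (1 : SpinConfig V → ℝ) ρ ≤ 1 := fun ρ i =>
    Set.indicator_apply_le' (fun _ => le_rfl) (fun _ => zero_le_one)
  dsimp only
  by_cases hτ : τ ∈ {σ : SpinConfig V | ∀ i ∈ B, σ i = 1}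
  · -- `n_B(τ) = 1`, so the right-hand side is `#B - 1`
    have hsumτ : (∑ i ∈ B, ({σ : SpinConfig V | σ i = 1}).indicator (1 : SpinConfig V → ℝ) τ) =
        #B := by
      rw [Finset.sum_congr rfl fun i hi => Set.indicator_of_mem (show τ ∈ {σ : SpinConfig V |
        σ i = 1} from hτ i hi) (1 : SpinConfig V → ℝ)]
      simp
    rw [Set.indicator_of_mem hτ, hsumτ, Pi.one_apply]
    by_cases hσ : σ ∈ {σ : SpinConfig V | ∀ i ∈ B, σ i = 1}
    · have hsumσ : (∑ i ∈ B, ({σ : SpinConfig V | σ i = 1}).indicator (1 : SpinConfig V → ℝ) σ) =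
          #B := by
        rw [Finset.sum_congr rfl fun i hi => Set.indicator_of_mem (show σ ∈ {σ : SpinConfig V |
          σ i = 1} from hσ i hi) (1 : SpinConfig V → ℝ)]
        simp
      rw [Set.indicator_of_mem hσ, hsumσ, Pi.one_apply]
    · -- some `j ∈ B` has `σ_j ≠ 1`: the `j`-term vanishes, the others are `≤ 1`
      rw [Set.indicator_of_notMem hσ, sub_zero]
      simp only [Set.mem_setOf_eq, not_forall] at hσ
      obtain ⟨j, hj, hσj⟩ := hσ
      have hj0 : ({σ : SpinConfig V | σ j = 1}).indicator (1 : SpinConfig V → ℝ) σ = 0 :=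
        Set.indicator_of_notMem (show σ ∉ {σ : SpinConfig V | σ j = 1} from hσj) _
      rw [← Finset.sum_erase B hj0]
      calc (∑ i ∈ B.erase j, ({σ : SpinConfig V | σ i = 1}).indicator (1 : SpinConfig V → ℝ) σ)
          ≤ ∑ _i ∈ B.erase j, (1 : ℝ) := Finset.sum_le_sum fun i _ => hle1 σ i
        _ = #B - 1 := by
          rw [Finset.sum_const, nsmul_eq_mul, mul_one, Finset.card_erase_of_mem hj,
            Nat.cast_sub (Finset.card_pos.2 ⟨j, hj⟩), Nat.cast_one]
  · -- `n_B(τ) = 0`, hence `n_B(σ) = 0`, and the sums compare termwise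
    have hσ : σ ∉ {σ : SpinConfig V | ∀ i ∈ B, σ i = 1} := fun hσ =>
      hτ (mem_forall_eq_one_of_le hle hσ)
    rw [Set.indicator_of_notMem hσ, Set.indicator_of_notMem hτ, sub_zero, sub_zero]
    exact Finset.sum_le_sum fun i _ => hterm i

end Events

/-! ### Finite volume: sandwich and gap bound (Friedli–Velenik 2017, Lemma 3.23, Thm. 3.28) -/

section FiniteVolume

variable {V : Type*} (G : SimpleGraph V) [DecidableEq V] [G.LocallyFinite]

/-- The probability of `{σ_i = 1}` is `(1 + ⟨σ_i⟩)/2`, i.e. `⟨n_i⟩` with `n_i = (1 + σ_i)/2`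
(Friedli–Velenik 2017, §3.6.2, p. 107). [cite: FriedliVelenik2017, §3.6.2, p. 107] -/
theorem measureReal_eq_one_eq (Λ : Finset V) (β h : ℝ) (bc : BoundaryCondition V) (i : V) :
    (isingMeasure G Λ β h bc).real {σ : SpinConfig V | σ i = 1} =
      (1 + isingExpect G Λ β h bc (spinAt i)) / 2 := by
  have hind : ({σ : SpinConfig V | σ i = 1}).indicator (1 : SpinConfig V → ℝ) =
      fun σ => (1 + spinAt i σ) / 2 := by
    funext σ
    by_cases hσ : σ i = 1
    · rw [Set.indicator_of_mem (show σ ∈ {σ : SpinConfig V | σ i = 1} from hσ)]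
      simp [spinAt, hσ]
    · rw [Set.indicator_of_notMem (show σ ∉ {σ : SpinConfig V | σ i = 1} from hσ)]
      rw [← ne_eq, ← intUnits_eq_neg_one_iff] at hσ
      simp [spinAt, hσ]
  have hint : Integrable (spinAt i) (isingMeasure G Λ β h bc) :=
    Integrable.of_bound (measurable_spinAt i).aestronglyMeasurable 1
      (Eventually.of_forall fun σ => by rw [Real.norm_eq_abs, abs_spinAt])
  rw [← integral_indicator_one (measurableSet_eq_one i), hind, integral_div, integral_add
    (integrable_const 1) hint, integral_const, smul_eq_mul, mul_one, probReal_univ, isingExpect]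

/-- **Monotonicity in the boundary condition on increasing cylinder events**
(Friedli–Velenik 2017, Lemma 3.23 / Exercise 3.13, pp. 112–113): for `β ≥ 0` and every boundary
condition `η`, `μ^η_{Λ;β,h}(σ_B ≡ +1) ≤ μ⁺_{Λ;β,h}(σ_B ≡ +1)`. [cite: FriedliVelenik2017, Lemma 3.23 and Exercise 3.13, pp. 112–113] -/
theorem measureReal_forall_eq_one_fixed_le_plus {β : ℝ} (hβ : 0 ≤ β) (Λ : Finset V) (h : ℝ)
    (η : SpinConfig V) (B : Finset V) :
    (isingMeasure G Λ β h (.fixed η)).real {σ : SpinConfig V | ∀ i ∈ B, σ i = 1} ≤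
      (isingMeasure G Λ β h .plus).real {σ : SpinConfig V | ∀ i ∈ B, σ i = 1} := by
  rw [← integral_indicator_one (measurableSet_forall_eq_one B),
    ← integral_indicator_one (measurableSet_forall_eq_one B)]
  exact integral_isingMeasure_fixed_mono G hβ Λ h (fun x => intUnits_le_one (η x))
    (monotone_indicator_forall_eq_one B) (measurable_one.indicator (measurableSet_forall_eq_one B))

/-- **Monotonicity in the boundary condition, `-` side** (Friedli–Velenik 2017, Lemma 3.23 /
Exercise 3.13, pp. 112–113): `μ⁻_{Λ;β,h}(σ_B ≡ +1) ≤ μ^η_{Λ;β,h}(σ_B ≡ +1)`. [cite: FriedliVelenik2017, Lemma 3.23 and Exercise 3.13, pp. 112–113] -/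
theorem measureReal_forall_eq_one_minus_le_fixed {β : ℝ} (hβ : 0 ≤ β) (Λ : Finset V) (h : ℝ)
    (η : SpinConfig V) (B : Finset V) :
    (isingMeasure G Λ β h .minus).real {σ : SpinConfig V | ∀ i ∈ B, σ i = 1} ≤
      (isingMeasure G Λ β h (.fixed η)).real {σ : SpinConfig V | ∀ i ∈ B, σ i = 1} := by
  rw [← integral_indicator_one (measurableSet_forall_eq_one B),
    ← integral_indicator_one (measurableSet_forall_eq_one B)]
  exact integral_isingMeasure_fixed_mono G hβ Λ h (fun x => neg_one_le_intUnits (η x))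
    (monotone_indicator_forall_eq_one B) (measurable_one.indicator (measurableSet_forall_eq_one B))

omit [DecidableEq V] in
/-- `∫ (∑_{i∈B} n_i - n_B) dρ = ∑_{i∈B} ρ(σ_i = 1) - ρ(σ_B ≡ +1)` for a finite measure `ρ`
(linearity; Friedli–Velenik 2017, proof of Thm. 3.28, p. 117, "using linearity"). [cite: FriedliVelenik2017, Thm. 3.28, p. 117] -/
theorem integral_sum_indicator_sub_indicator (ρ : Measure (SpinConfig V)) [IsFiniteMeasure ρ]
    (B : Finset V) :
    ∫ σ, ((∑ i ∈ B, ({σ : SpinConfig V | σ i = 1}).indicator (1 : SpinConfig V → ℝ) σ) -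
        ({σ : SpinConfig V | ∀ i ∈ B, σ i = 1}).indicator (1 : SpinConfig V → ℝ) σ) ∂ρ =
      (∑ i ∈ B, ρ.real {σ : SpinConfig V | σ i = 1}) -
        ρ.real {σ : SpinConfig V | ∀ i ∈ B, σ i = 1} := by
  have hi : ∀ i : V, Integrable (({σ : SpinConfig V | σ i = 1}).indicator (1 : SpinConfig V → ℝ)) ρ :=
    fun i => (integrable_const (1 : ℝ)).indicator (measurableSet_eq_one i)
  have hB : Integrable (({σ : SpinConfig V | ∀ i ∈ B, σ i = 1}).indicator (1 : SpinConfig V → ℝ)) ρ :=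
    (integrable_const (1 : ℝ)).indicator (measurableSet_forall_eq_one B)
  rw [integral_sub (integrable_finsetSum B fun i _ => hi i) hB, integral_finsetSum B fun i _ => hi i,
    integral_indicator_one (measurableSet_forall_eq_one B)]
  congr 1
  exact Finset.sum_congr rfl fun i _ => integral_indicator_one (measurableSet_eq_one i)

/-- **The gap bound of Friedli–Velenik 2017, proof of Thm. 3.28 (p. 117), in finite volume**:
since `∑_{i ∈ B} n_i - n_B` is nondecreasing (Exercise 3.10) and `⟨·⟩⁻_Λ ≤ ⟨·⟩⁺_Λ` on
nondecreasing functions (Lemma 3.23), for `β ≥ 0`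
`μ⁺_Λ(σ_B ≡ +1) - μ⁻_Λ(σ_B ≡ +1) ≤ ∑_{i ∈ B} (μ⁺_Λ(σ_i = 1) - μ⁻_Λ(σ_i = 1))`. [cite: FriedliVelenik2017, Thm. 3.28, p. 117] -/
theorem measureReal_plus_sub_minus_le_sum {β : ℝ} (hβ : 0 ≤ β) (Λ : Finset V) (h : ℝ)
    (B : Finset V) :
    (isingMeasure G Λ β h .plus).real {σ : SpinConfig V | ∀ i ∈ B, σ i = 1} -
        (isingMeasure G Λ β h .minus).real {σ : SpinConfig V | ∀ i ∈ B, σ i = 1} ≤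
      ∑ i ∈ B, ((isingMeasure G Λ β h .plus).real {σ : SpinConfig V | σ i = 1} -
        (isingMeasure G Λ β h .minus).real {σ : SpinConfig V | σ i = 1}) := by
  have hmeas : Measurable fun σ : SpinConfig V =>
      (∑ i ∈ B, ({σ : SpinConfig V | σ i = 1}).indicator (1 : SpinConfig V → ℝ) σ) -
        ({σ : SpinConfig V | ∀ i ∈ B, σ i = 1}).indicator (1 : SpinConfig V → ℝ) σ :=
    (Finset.measurable_sum B fun i _ => measurable_one.indicator (measurableSet_eq_one i)).sub
      (measurable_one.indicator (measurableSet_forall_eq_one B))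
  have key := integral_isingMeasure_fixed_mono G hβ Λ h
    (fun x => neg_one_le_intUnits ((1 : SpinConfig V) x))
    (monotone_sum_indicator_sub_indicator B) hmeas
  rw [integral_sum_indicator_sub_indicator, integral_sum_indicator_sub_indicator] at key
  rw [Finset.sum_sub_distrib]
  -- `key : ∑ μ⁻(E_i) - μ⁻(E_B) ≤ ∑ μ⁺(E_i) - μ⁺(E_B)` (with `.minus = .fixed (-1)`, `.plus = .fixed 1`)
  change (∑ i ∈ B, (isingMeasure G Λ β h (.fixed (-1))).real {σ : SpinConfig V | σ i = 1}) -
      (isingMeasure G Λ β h (.fixed (-1))).real {σ : SpinConfig V | ∀ i ∈ B, σ i = 1} ≤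
    (∑ i ∈ B, (isingMeasure G Λ β h (.fixed 1)).real {σ : SpinConfig V | σ i = 1}) -
      (isingMeasure G Λ β h (.fixed 1)).real {σ : SpinConfig V | ∀ i ∈ B, σ i = 1} at key
  change (isingMeasure G Λ β h (.fixed 1)).real {σ : SpinConfig V | ∀ i ∈ B, σ i = 1} -
      (isingMeasure G Λ β h (.fixed (-1))).real {σ : SpinConfig V | ∀ i ∈ B, σ i = 1} ≤
    (∑ i ∈ B, (isingMeasure G Λ β h (.fixed 1)).real {σ : SpinConfig V | σ i = 1}) -
      ∑ i ∈ B, (isingMeasure G Λ β h (.fixed (-1))).real {σ : SpinConfig V | σ i = 1}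
  linarith

/-- **Spin-flip symmetry at `h = 0`** (Friedli–Velenik 2017, §3.7.2, p. 120:
"`⟨σ_0⟩⁻_{β,0} = -⟨σ_0⟩⁺_{β,0}` by symmetry"; tree theorem `isingCorr_fixed_flip_holds`):
`⟨σ_i⟩⁻_{Λ;β,0} = -⟨σ_i⟩⁺_{Λ;β,0}`. [cite: FriedliVelenik2017, §3.7.2, p. 120] -/
theorem isingExpect_minus_spinAt_eq_neg (Λ : Finset V) (β : ℝ) (i : V) :
    isingExpect G Λ β 0 .minus (spinAt i) = -isingExpect G Λ β 0 .plus (spinAt i) := by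
  have hflip := isingCorr_fixed_flip_holds G Λ β 0 1 {i}
  rw [neg_zero] at hflip
  change isingExpect G Λ β 0 (.fixed (-1)) (spinAt i) = -isingExpect G Λ β 0 (.fixed 1) (spinAt i)
  simpa [isingCorr, spinProduct_singleton] using hflip

/-- At `h = 0` the single-site gap is the finite-volume plus magnetisation:
`μ⁺_{Λ;β,0}(σ_i = 1) - μ⁻_{Λ;β,0}(σ_i = 1) = ⟨n_i⟩⁺ - ⟨n_i⟩⁻ = ½(⟨σ_i⟩⁺ - ⟨σ_i⟩⁻) = ⟨σ_i⟩⁺_{Λ;β,0}`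
(Friedli–Velenik 2017, proof of Thm. 3.28, p. 117, with the symmetry of §3.7.2, p. 120). [cite: FriedliVelenik2017, Thm. 3.28, p. 117 and §3.7.2, p. 120] -/
theorem measureReal_plus_sub_minus_eq_one_eq (Λ : Finset V) (β : ℝ) (i : V) :
    (isingMeasure G Λ β 0 .plus).real {σ : SpinConfig V | σ i = 1} -
        (isingMeasure G Λ β 0 .minus).real {σ : SpinConfig V | σ i = 1} =
      isingExpect G Λ β 0 .plus (spinAt i) := by
  rw [measureReal_eq_one_eq, measureReal_eq_one_eq, isingExpect_minus_spinAt_eq_neg]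
  ring

end FiniteVolume

/-! ### The DLR sandwich and the uniqueness criterion (Friedli–Velenik 2017, Thm. 3.28, (6.70)) -/

section Criterion

variable {V : Type*} (G : SimpleGraph V) [DecidableEq V] [G.LocallyFinite]

/-- **DLR sandwich** (Friedli–Velenik 2017, Lemma 6.65, eq. (6.70), p. 311:
`ν(f) = ∫ μ^η_Λ(f) ν(dη) ≤ μ⁺_Λ(f)`): if `μ` is a Gibbs measure for the Ising specification and
the finite-volume probabilities `μ^η_{Λ;β,h}(E)` of a measurable event lie in `[m, M]` for every
boundary condition `η`, then so does `μ(E)` (the DLR equation `μ(E) = ∫ μ^η_Λ(E) μ(dη)`). [cite: FriedliVelenik2017, Lemma 6.65, eq. (6.70), p. 311] -/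
theorem measureReal_mem_of_isGibbsMeasure {β h : ℝ} {μ : Measure (SpinConfig V)}
    (hμ : IsGibbsMeasure (isingSpecification G β h) μ) (Λ : Finset V) {E : Set (SpinConfig V)}
    (hE : MeasurableSet E) {m M : ℝ}
    (hm : ∀ η : SpinConfig V, m ≤ (isingMeasure G Λ β h (.fixed η)).real E)
    (hM : ∀ η : SpinConfig V, (isingMeasure G Λ β h (.fixed η)).real E ≤ M) :
    m ≤ μ.real E ∧ μ.real E ≤ M := by
  haveI : IsProbabilityMeasure μ := hμ.1
  have hDLR : ∫⁻ η, isingMeasure G Λ β h (.fixed η) E ∂μ = μ E := hμ.2 Λ E hE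
  have hofReal : ∀ η : SpinConfig V, isingMeasure G Λ β h (.fixed η) E =
      ENNReal.ofReal ((isingMeasure G Λ β h (.fixed η)).real E) := fun η =>
    (ofReal_measureReal (measure_ne_top _ _)).symm
  constructor
  · have h1 : ENNReal.ofReal m ≤ μ E := by
      calc ENNReal.ofReal m = ∫⁻ _, ENNReal.ofReal m ∂μ := by
            rw [lintegral_const, measure_univ, mul_one]
        _ ≤ ∫⁻ η, isingMeasure G Λ β h (.fixed η) E ∂μ :=
            lintegral_mono fun η => by rw [hofReal η]; exact ENNReal.ofReal_le_ofReal (hm η)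
        _ = μ E := hDLR
    exact (ENNReal.ofReal_le_iff_le_toReal (measure_ne_top μ E)).1 h1
  · have hM0 : 0 ≤ M := measureReal_nonneg.trans (hM 1)
    have h2 : μ E ≤ ENNReal.ofReal M := by
      calc μ E = ∫⁻ η, isingMeasure G Λ β h (.fixed η) E ∂μ := hDLR.symm
        _ ≤ ∫⁻ _, ENNReal.ofReal M ∂μ :=
            lintegral_mono fun η => by rw [hofReal η]; exact ENNReal.ofReal_le_ofReal (hM η)
        _ = ENNReal.ofReal M := by rw [lintegral_const, measure_univ, mul_one]
    exact ENNReal.toReal_le_of_le_ofReal hM0 h2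

/-- **Two Gibbs measures differ on `{σ_B ≡ +1}` by at most the finite-volume gap**
(Friedli–Velenik 2017, Thm. 3.28, proof of `2 ⇒ 1` and `3 ⇒ 2`, p. 117, in finite volume): for
`β ≥ 0`, `μ, ν ∈ 𝒢(β, h)` and every finite `Λ`,
`|μ(σ_B ≡ +1) - ν(σ_B ≡ +1)| ≤ ∑_{i ∈ B} (μ⁺_Λ(σ_i = 1) - μ⁻_Λ(σ_i = 1))`. [cite: FriedliVelenik2017, Thm. 3.28, p. 117] -/
theorem abs_measureReal_sub_le_sum_of_isGibbsMeasure {β : ℝ} (hβ : 0 ≤ β) (h : ℝ)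
    {μ ν : Measure (SpinConfig V)} (hμ : IsGibbsMeasure (isingSpecification G β h) μ)
    (hν : IsGibbsMeasure (isingSpecification G β h) ν) (Λ B : Finset V) :
    |μ.real {σ : SpinConfig V | ∀ i ∈ B, σ i = 1} - ν.real {σ : SpinConfig V | ∀ i ∈ B, σ i = 1}| ≤
      ∑ i ∈ B, ((isingMeasure G Λ β h .plus).real {σ : SpinConfig V | σ i = 1} -
        (isingMeasure G Λ β h .minus).real {σ : SpinConfig V | σ i = 1}) := by
  obtain ⟨hμ1, hμ2⟩ := measureReal_mem_of_isGibbsMeasure G hμ Λ (measurableSet_forall_eq_one B)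
    (fun η => measureReal_forall_eq_one_minus_le_fixed G hβ Λ h η B)
    (fun η => measureReal_forall_eq_one_fixed_le_plus G hβ Λ h η B)
  obtain ⟨hν1, hν2⟩ := measureReal_mem_of_isGibbsMeasure G hν Λ (measurableSet_forall_eq_one B)
    (fun η => measureReal_forall_eq_one_minus_le_fixed G hβ Λ h η B)
    (fun η => measureReal_forall_eq_one_fixed_le_plus G hβ Λ h η B)
  have hgap := measureReal_plus_sub_minus_le_sum G hβ Λ h B
  rw [abs_sub_le_iff]
  constructor <;> linarith

/-- The increasing cylinder events `{σ_B ≡ +1}`, `B` finite, form a `π`-system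
(`E_B ∩ E_{B'} = E_{B ∪ B'}`). [folklore] -/
theorem isPiSystem_range_forall_eq_one :
    IsPiSystem (Set.range fun B : Finset V => {σ : SpinConfig V | ∀ i ∈ B, σ i = 1}) := by
  classical
  rintro _ ⟨B₁, rfl⟩ _ ⟨B₂, rfl⟩ _
  refine ⟨B₁ ∪ B₂, ?_⟩
  ext σ
  simp only [Set.mem_setOf_eq, Set.mem_inter_iff, Finset.mem_union, or_imp, forall_and]

omit [DecidableEq V] in
/-- The increasing cylinder events `{σ_B ≡ +1}`, `B` finite, generate the product `σ`-algebra of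
`{±1}^V` (each coordinate `σ ↦ σ_i ∈ {±1}` is measurable for the generated `σ`-algebra, since
`{σ_i = 1} = E_{{i}}` and `{σ_i = -1} = E_{{i}}ᶜ`). [folklore] -/
theorem generateFrom_range_forall_eq_one :
    (MeasurableSpace.pi : MeasurableSpace (SpinConfig V)) =
      MeasurableSpace.generateFrom
        (Set.range fun B : Finset V => {σ : SpinConfig V | ∀ i ∈ B, σ i = 1}) := by
  set C : Set (Set (SpinConfig V)) :=
    Set.range fun B : Finset V => {σ : SpinConfig V | ∀ i ∈ B, σ i = 1} with hC
  have hsingle : ∀ i : V, {σ : SpinConfig V | ∀ j ∈ ({i} : Finset V), σ j = 1} =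
      (fun σ : SpinConfig V => σ i) ⁻¹' {1} := fun i => by
    ext σ; simp
  have hmeas : ∀ i : V, Measurable[MeasurableSpace.generateFrom C] fun σ : SpinConfig V => σ i := by
    intro i
    refine @measurable_to_countable' ℤˣ (SpinConfig V) _ _ (MeasurableSpace.generateFrom C) _
      fun u => ?_
    have h1 : MeasurableSet[MeasurableSpace.generateFrom C]
        ((fun σ : SpinConfig V => σ i) ⁻¹' {1}) :=
      MeasurableSpace.measurableSet_generateFrom ⟨{i}, hsingle i⟩
    rcases Int.units_eq_one_or u with rfl | rfl
    · exact h1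
    · have hc : (fun σ : SpinConfig V => σ i) ⁻¹' {-1} = ((fun σ : SpinConfig V => σ i) ⁻¹' {1})ᶜ := by
        ext σ
        simp only [Set.mem_preimage, Set.mem_singleton_iff, Set.mem_compl_iff]
        exact intUnits_eq_neg_one_iff (σ i)
      rw [hc]
      exact h1.compl
  refine le_antisymm (iSup_le fun i => (hmeas i).comap_le) (MeasurableSpace.generateFrom_le ?_)
  rintro _ ⟨B, rfl⟩
  exact measurableSet_forall_eq_one B

/-- **Uniqueness criterion in finite-volume form** (Friedli–Velenik 2017, Thm. 3.28, p. 117,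
`3 ⇒ 2 ⇒ 1`, combined with eq. (6.70), p. 311): for the Ising model on a locally finite graph at
`β ≥ 0` and field `h`, if along some sequence of finite volumes `Λ_n` every single-site gap
`μ⁺_{Λ_n}(σ_i = 1) - μ⁻_{Λ_n}(σ_i = 1)` tends to `0`, then the Ising specification admits at most
one Gibbs measure: all Gibbs measures agree on the generating `π`-system `{σ_B ≡ +1}`. [cite: FriedliVelenik2017, Thm. 3.28, p. 117] -/
theorem subsingleton_gibbsMeasures_isingSpecification_of_tendsto {β : ℝ} (hβ : 0 ≤ β) (h : ℝ)
    (Λ : ℕ → Finset V)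
    (hgap : ∀ i : V, Tendsto (fun n => (isingMeasure G (Λ n) β h .plus).real
        {σ : SpinConfig V | σ i = 1} - (isingMeasure G (Λ n) β h .minus).real
        {σ : SpinConfig V | σ i = 1}) atTop (𝓝 0)) :
    (gibbsMeasures (isingSpecification G β h)).Subsingleton := by
  intro μ hμ ν hν
  have hμ' : IsGibbsMeasure (isingSpecification G β h) μ := hμ
  have hν' : IsGibbsMeasure (isingSpecification G β h) ν := hν
  haveI : IsProbabilityMeasure μ := hμ'.1
  haveI : IsProbabilityMeasure ν := hν'.1
  refine ext_of_generate_finite _ generateFrom_range_forall_eq_one isPiSystem_range_forall_eq_one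
    ?_ (by rw [measure_univ, measure_univ])
  rintro _ ⟨B, rfl⟩
  have hbound : ∀ n, |μ.real {σ : SpinConfig V | ∀ i ∈ B, σ i = 1} -
      ν.real {σ : SpinConfig V | ∀ i ∈ B, σ i = 1}| ≤
        ∑ i ∈ B, ((isingMeasure G (Λ n) β h .plus).real {σ : SpinConfig V | σ i = 1} -
          (isingMeasure G (Λ n) β h .minus).real {σ : SpinConfig V | σ i = 1}) := fun n =>
    abs_measureReal_sub_le_sum_of_isGibbsMeasure G hβ h hμ' hν' (Λ n) B
  have hlim : Tendsto (fun n => ∑ i ∈ B, ((isingMeasure G (Λ n) β h .plus).real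
      {σ : SpinConfig V | σ i = 1} - (isingMeasure G (Λ n) β h .minus).real
      {σ : SpinConfig V | σ i = 1})) atTop (𝓝 0) := by
    have hs := tendsto_finsetSum B fun i _ => hgap i
    simpa using hs
  have h0 : |μ.real {σ : SpinConfig V | ∀ i ∈ B, σ i = 1} -
      ν.real {σ : SpinConfig V | ∀ i ∈ B, σ i = 1}| ≤ 0 :=
    le_of_tendsto_of_tendsto' tendsto_const_nhds hlim hbound
  have heq : μ.real {σ : SpinConfig V | ∀ i ∈ B, σ i = 1} =
      ν.real {σ : SpinConfig V | ∀ i ∈ B, σ i = 1} :=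
    sub_eq_zero.1 (abs_nonpos_iff.1 h0)
  dsimp only
  rw [← ofReal_measureReal (measure_ne_top μ _), ← ofReal_measureReal (measure_ne_top ν _), heq]

/-- **Uniqueness criterion at `h = 0`** (Friedli–Velenik 2017, Thm. 3.28 with §3.7.2, p. 120:
at `h = 0`, by the symmetry `⟨σ_i⟩⁻ = -⟨σ_i⟩⁺`, uniqueness follows from `⟨σ_i⟩⁺ → 0`): if along
some sequence of volumes the finite-volume plus magnetisations `⟨σ_i⟩⁺_{Λ_n;β,0}` tend to `0` for
every site `i`, the Ising specification at `(β, 0)` has at most one Gibbs measure. [cite: FriedliVelenik2017, Thm. 3.28, p. 117 and §3.7.2, p. 120] -/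
theorem subsingleton_gibbsMeasures_isingSpecification_of_tendsto_plus {β : ℝ} (hβ : 0 ≤ β)
    (Λ : ℕ → Finset V)
    (hplus : ∀ i : V, Tendsto (fun n => isingExpect G (Λ n) β 0 .plus (spinAt i)) atTop (𝓝 0)) :
    (gibbsMeasures (isingSpecification G β 0)).Subsingleton :=
  subsingleton_gibbsMeasures_isingSpecification_of_tendsto G hβ 0 Λ fun i =>
    (hplus i).congr fun n => (measureReal_plus_sub_minus_eq_one_eq G (Λ n) β i).symm

end Criterion

/-! ### The nearest-neighbour model on `ℤ^d`: discharges -/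

section Lattice

variable {d : ℕ} {β : ℝ}

/-- **ADS15 Prop. B.1 (a) ⇒ (b), proved** (Aizenman–Duminil-Copin–Sidoravicius, CMP 334 (2015),
Prop. B.1, after Lebowitz–Martin-Löf 1972; Friedli–Velenik 2017, Thm. 3.28 with §3.7.2, p. 120):
discharge of the named fact `hasUniqueGibbsMeasure_of_plusExpect_spinAt_eq_zero` of
`MagnetizationContinuity.lean` — for the nearest-neighbour Ising model on `ℤ^d` at `β ≥ 0`, if
`⟨σ_x⟩⁺_{β,0} = 0` for all `x` then `|𝒢(β, 0)| = 1`. Existence is the free state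
(`exists_freeMeasure_holds`); uniqueness is the criterion above along boxes, where
`⟨σ_x⟩⁺_{Λ_L;β,0} → ⟨σ_x⟩⁺_{β,0} = 0` (`hasBoxLimit_isingCorr_plus_holds`). [cite: AizenmanDuminilCopinSidoraviciusCMP2015, Prop. B.1 (Appendix B)] -/
theorem hasUniqueGibbsMeasure_of_plusExpect_spinAt_eq_zero_holds :
    hasUniqueGibbsMeasure_of_plusExpect_spinAt_eq_zero (d := d) := by
  intro β hβ hzero
  refine ⟨?_, ?_⟩
  · refine subsingleton_gibbsMeasures_isingSpecification_of_tendsto_plus (zdGraph d) hβ (box d)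
      fun x => ?_
    have hx := tendsto_isingExpect_plus_spinAt hasBoxLimit_isingCorr_plus_holds hβ x
    rwa [hzero x] at hx
  · obtain ⟨μ, hμ, -, -⟩ := exists_freeMeasure_holds d (β := β) 0 hβ le_rfl
    exact ⟨μ, hμ⟩

/-- **crit-ising.S25, proved: uniqueness below `β_c`** (Lebowitz–Martin-Löf, CMP 25 (1972) 276;
Friedli–Velenik 2017, Thm. 3.28 with Def. 3.32 / eq. (3.27), p. 120: `m*(β) = 0` for `β < β_c`,
hence `⟨σ_x⟩⁺_{β,0} = m*(β) = 0` and uniqueness): discharge of the named fact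
`hasUniqueGibbsMeasure_of_lt_criticalBeta` of `GibbsStates.lean` — for `0 ≤ β < β_c(d)` the Ising
specification on `ℤ^d` at zero field admits exactly one Gibbs measure. (The hypothesis `2 ≤ d`
of the fact is not needed: for `d ≤ 1` the junk value `β_c = 0` makes it vacuous.) [cite: FriedliVelenik2017, Thm. 3.28, p. 117 and Def. 3.32, p. 120] -/
theorem hasUniqueGibbsMeasure_of_lt_criticalBeta_holds :
    hasUniqueGibbsMeasure_of_lt_criticalBeta (d := d) (β := β) := by
  intro _ hβ hlt
  -- `m*(β) = 0` for `β < β_c = inf {β ≥ 0 | m*(β) > 0}` since `m* ≥ 0` (GKS I in the limit)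
  have hm : spontaneousMagnetization d β = 0 :=
    le_antisymm (not_lt.1 fun hpos => not_le.2 hlt (csInf_le ⟨0, fun _ hb => hb.1⟩ ⟨hβ, hpos⟩))
      (spontaneousMagnetization_nonneg_holds (d := d) hβ)
  exact hasUniqueGibbsMeasure_of_plusExpect_spinAt_eq_zero_holds hβ fun x =>
    (plusExpect_spinAt_eq_spontaneousMagnetization_holds hβ x).trans hm

/-- **ADS15 Theorem 1.2, second assertion, proved** (Aizenman–Duminil-Copin–Sidoravicius, CMP
334 (2015), Thm. 1.2: `M̃_LRO(β_c) = 0 ⇒` a unique Gibbs state at `β_c`): discharge of the named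
fact `hasUniqueGibbsMeasure_criticalBeta_of_lroTildeSq` of `MagnetizationContinuity.lean`, from
the §3.2 ingredients (all tree theorems: `plusPair_eq_freePair_of_lroTildeSq_holds`, FKG,
translation invariance) and Prop. B.1 (`hasUniqueGibbsMeasure_of_plusExpect_spinAt_eq_zero_holds`). [cite: AizenmanDuminilCopinSidoraviciusCMP2015, Thm. 1.2, §3.2 and Prop. B.1] -/
theorem hasUniqueGibbsMeasure_criticalBeta_of_lroTildeSq_holds :
    hasUniqueGibbsMeasure_criticalBeta_of_lroTildeSq (d := d) :=
  hasUniqueGibbsMeasure_criticalBeta_of_lroTildeSq_of_ingredients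
    plusPair_eq_freePair_of_lroTildeSq_holds plusExpect_spinAt_mul_le_plusPair_holds
    plusExpect_spinAt_eq_spontaneousMagnetization_holds
    hasUniqueGibbsMeasure_of_plusExpect_spinAt_eq_zero_holds

/-- **crit-ising.S09, proved: uniqueness of the Gibbs measure at criticality for `d ≥ 3`**
(Aizenman–Duminil-Copin–Sidoravicius, CMP 334 (2015), Thm. 1.2 with Cor. 1.5 (1): continuity of
the magnetisation, `m*(β_c) = 0`, implies a unique Gibbs state at `β_c`; the step
`m*(β) = 0 ⇒ |𝒢(β,0)| = 1` is Friedli–Velenik 2017, Thm. 3.28 with §3.7.2, p. 120, proved above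
via Lemma 3.23 / Exercise 3.13 and the DLR sandwich (6.70)). Discharge of the named fact
`hasUniqueGibbsMeasure_criticalBeta` of `Sharpness.lean`: for `d ≥ 3` the Ising specification on
`ℤ^d` at `(β_c, 0)` admits exactly one infinite-volume Gibbs measure. Every input is a theorem of
the tree: `M̃_LRO(β_c) = 0` (`lroTildeSq_criticalBeta_eq_zero_holds`, infrared bound), the
random-current identity `⟨σ_xσ_y⟩⁺ = ⟨σ_xσ_y⟩⁰` (`plusPair_eq_freePair_of_lroTildeSq_holds`), FKG and
translation invariance of the plus state, and the existence of the free DLR state. [cite: FriedliVelenik2017, Thm. 3.28 with Prop. 3.29 / Thm. 6.63] [cite: AizenmanDuminilCopinSidoraviciusCMP2015, Thm. 1.2 with Cor. 1.5 (1)] -/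
theorem hasUniqueGibbsMeasure_criticalBeta_holds : hasUniqueGibbsMeasure_criticalBeta (d := d) :=
  hasUniqueGibbsMeasure_criticalBeta_of_ads hasUniqueGibbsMeasure_criticalBeta_of_lroTildeSq_holds
    lroTildeSq_criticalBeta_eq_zero_holds

end Lattice

end Literature.Probability.LatticeModels

end
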